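/-
Copyright: the b2b-balaban cell (near-miss cell 7), T⁴-continuum fan-out; row NE7b ROUND-2 swarm, seat
t4-ne7b-formalise-leaf-05 gen 2 (row S6g′ binding of `t4/b2b-balaban-t4-ne7b-p1/LEAVES-NE7b.md`, owner's ruling R-OWNER-22-12 (2)).
Released under the licence of the surrounding project.
-/
import Summits.QuantumFields.BalabanUV.T4Continuum.Support.HistoryJoins

/-!
# History joins, part 1b: the CLUSTER ROOTS (the joins of a shape tree, with their paths)

Summits-side support leaf of the T⁴-continuum cell (rung (B)+1 on a FINITE torus only; NOT infinite volume, NOT the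
mass gap, NOT the Clay statement; NOT a proof of the spine estimate NE7b).  Row NE7b, route «COUNT»; row S6g′, the
binding's tree surgery continued from `HistoryJoins`.  [folklore] structural recursion over `Gen ε`; nothing is quoted
from print, nothing printed is asserted, no `[cite:]` tag, no `Prop` fact of Bałaban's.

WHAT.  **`crootsP st parent G`** ∕ **`croots st G`**: the JOINS of `G` — the mergers whose step differs from their parent
cluster's step (renewals close clusters), each with its path from the top; `exists_eq_merge_of_mem_crootsP`;
`crootsP_some_of_closed`; **`mem_crootsP_some_iff`** (below a step-`t` parent the joins are the joins of the step-`t`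
parts, shifted by the parts' paths) and **`mem_croots_merge_iff`** (the joins of a merger are its TOP join and the joins
of the top join's parts, shifted) — the decomposition along which part 2's canonical admissibility (a conjunction of
LOCAL join conditions over `croots`) splits into «top join» ∧ «parts canonically admissible».  Sanity at the end.

HONEST SCOPE.  Tree surgery only.  NE7b NOT proved.  HONEST DEPENDENCY (cell): continuum YM on T⁴ ⇐ BetaPertH ∧ nine
spine estimates (0/9 proved); BetaPertH ⇐ (D1) ∧ (D4) ∧ CAP+tail.  This file changes none of it.
-/

open Finset
open Literature.MathematicalPhysics.QuantumFieldTheory.Balaban1983to89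
open T4PersistenceDictionary T4PartnerMultiplicity T4BranchingRecordsGas

namespace Summit.QuantumFields.BalabanUV.T4Continuum.HistoryJoins

variable {ε : Type*}

/-! ## §1 Cluster roots: the joins of `G`, with their paths -/

section Roots

variable (st : ε → ℕ)

/-- the cluster roots below a node whose parent cluster has step `parent` (`none` at the top and under a renewal): a
merger is a ROOT iff its step differs from its parent's. [folklore] -/
def crootsP : Option ℕ → Gen ε → List (List Bool × Gen ε)
  | _, Gen.born _ _ => []
  | _, Gen.renew G _ _ => crootsP none G
  | p, Gen.merge X Y e =>
      (if p = some (st e) then [] else [([], Gen.merge X Y e)]) ++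
        ((crootsP (some (st e)) X).map (fun q => (false :: q.1, q.2)) ++
          (crootsP (some (st e)) Y).map (fun q => (true :: q.1, q.2)))

/-- **THE JOINS OF `G`** (cluster roots with their paths). [folklore] -/
def croots (G : Gen ε) : List (List Bool × Gen ε) := crootsP st none G

/-- every join is a merger [folklore] -/
theorem exists_eq_merge_of_mem_crootsP : ∀ (p : Option ℕ) (G : Gen ε), ∀ q ∈ crootsP st p G,
    ∃ X Y e, q.2 = Gen.merge X Y e
  | p, Gen.born b j, q, hq => by simp [crootsP] at hq
  | p, Gen.renew G e h, q, hq => exists_eq_merge_of_mem_crootsP none G q hq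
  | p, Gen.merge X Y e, q, hq => by
      simp only [crootsP, List.mem_append, List.mem_map] at hq
      rcases hq with hq | ⟨q', hq', rfl⟩ | ⟨q', hq', rfl⟩
      · split_ifs at hq with hp
        · simp at hq
        · rw [List.mem_singleton] at hq
          exact ⟨X, Y, e, by rw [hq]⟩
      · exact exists_eq_merge_of_mem_crootsP _ X q' hq'
      · exact exists_eq_merge_of_mem_crootsP _ Y q' hq'

/-- under a foreign step the roots are those of the node itself [folklore] -/
theorem crootsP_some_of_closed {t : ℕ} :
    ∀ G : Gen ε, clusterParts st t G = [([], G)] → crootsP st (some t) G = croots st G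
  | Gen.born b j, _ => rfl
  | Gen.renew G e h, _ => rfl
  | Gen.merge X Y e, hc => by
      have he : st e ≠ t := by
        intro he
        rw [clusterParts_merge_of_eq st he] at hc
        -- both partners contribute at least one part: the list has length ≥ 2
        have h1 := one_le_length_clusterParts st t X
        have h2 := one_le_length_clusterParts st t Y
        have := congrArg List.length hc
        simp at this; omega
      simp [crootsP, croots, Ne.symm he]

/-- **THE JOINS BELOW A STEP-`t` PARENT ARE THE JOINS OF THE STEP-`t` PARTS, SHIFTED.** [folklore] -/
theorem mem_crootsP_some_iff (t : ℕ) :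
    ∀ (G : Gen ε) (q : List Bool × Gen ε),
      q ∈ crootsP st (some t) G ↔ ∃ p ∈ clusterParts st t G, ∃ q' ∈ croots st p.2, q = (p.1 ++ q'.1, q'.2)
  | Gen.born b j, q => by simp [crootsP, croots]
  | Gen.renew G e h, q => by
      simp only [clusterParts_renew, List.mem_singleton, exists_eq_left, List.nil_append]
      constructor
      · intro hq; exact ⟨q, hq, by simp⟩
      · rintro ⟨q', hq', rfl⟩; simpa [crootsP, croots] using hq'
  | Gen.merge X Y e, q => by
      by_cases he : st e = t
      · subst he
        rw [clusterParts_merge_of_eq st rfl]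
        have hX := fun q => mem_crootsP_some_iff (st e) X q
        have hY := fun q => mem_crootsP_some_iff (st e) Y q
        simp only [crootsP, if_true, List.nil_append, List.mem_append, List.mem_map]
        constructor
        · rintro (⟨q₁, hq₁, rfl⟩ | ⟨q₁, hq₁, rfl⟩)
          · obtain ⟨p, hp, q', hq', rfl⟩ := (hX q₁).1 hq₁
            exact ⟨(false :: p.1, p.2), Or.inl ⟨p, hp, rfl⟩, q', hq', by simp⟩
          · obtain ⟨p, hp, q', hq', rfl⟩ := (hY q₁).1 hq₁
            exact ⟨(true :: p.1, p.2), Or.inr ⟨p, hp, rfl⟩, q', hq', by simp⟩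
        · rintro ⟨p, (⟨p', hp', rfl⟩ | ⟨p', hp', rfl⟩), q', hq', rfl⟩
          · exact Or.inl ⟨(p'.1 ++ q'.1, q'.2), (hX _).2 ⟨p', hp', q', hq', rfl⟩, by simp⟩
          · exact Or.inr ⟨(p'.1 ++ q'.1, q'.2), (hY _).2 ⟨p', hp', q', hq', rfl⟩, by simp⟩
      · have hc := clusterParts_merge_of_ne st he (X := X) (Y := Y)
        rw [crootsP_some_of_closed st _ hc, hc]
        simp only [List.mem_singleton, exists_eq_left, List.nil_append]
        constructor
        · intro hq; exact ⟨q, hq, by simp⟩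
        · rintro ⟨q', hq', rfl⟩; simpa using hq'

/-- **THE JOINS OF A MERGER ARE ITS TOP JOIN AND THE JOINS OF THE TOP JOIN'S PARTS, SHIFTED.** [folklore] -/
theorem mem_croots_merge_iff (X Y : Gen ε) (e : ε) (q : List Bool × Gen ε) :
    q ∈ croots st (Gen.merge X Y e) ↔
      q = ([], Gen.merge X Y e) ∨ ∃ p ∈ jparts st (Gen.merge X Y e), ∃ q' ∈ croots st p.2, q = (p.1 ++ q'.1, q'.2) := by
  rw [jparts_merge]
  simp only [croots, crootsP, List.mem_append, List.mem_map]
  have hX := mem_crootsP_some_iff st (st e) X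
  have hY := mem_crootsP_some_iff st (st e) Y
  simp only [croots] at hX hY
  constructor
  · rintro (hq | ⟨q₁, hq₁, rfl⟩ | ⟨q₁, hq₁, rfl⟩)
    · simp at hq; exact Or.inl hq
    · obtain ⟨p, hp, q', hq', rfl⟩ := (hX q₁).1 hq₁
      exact Or.inr ⟨(false :: p.1, p.2), Or.inl ⟨p, hp, rfl⟩, q', hq', by simp⟩
    · obtain ⟨p, hp, q', hq', rfl⟩ := (hY q₁).1 hq₁
      exact Or.inr ⟨(true :: p.1, p.2), Or.inr ⟨p, hp, rfl⟩, q', hq', by simp⟩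
  · rintro (rfl | ⟨p, (⟨p', hp', rfl⟩ | ⟨p', hp', rfl⟩), q', hq', rfl⟩)
    · exact Or.inl (by simp)
    · exact Or.inr (Or.inl ⟨(p'.1 ++ q'.1, q'.2), (hX _).2 ⟨p', hp', q', hq', rfl⟩, by simp⟩)
    · exact Or.inr (Or.inr ⟨(p'.1 ++ q'.1, q'.2), (hY _).2 ⟨p', hp', q', hq', rfl⟩, by simp⟩)

/-- joins of a bare birth: none [folklore] -/
@[simp] theorem croots_born (b : ε) (j : ℕ) : croots st (Gen.born b j) = [] := rfl

/-- joins of a renewal: those of the renewed structure [folklore] -/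
@[simp] theorem croots_renew (G : Gen ε) (e : ε) (h : ℕ) : croots st (Gen.renew G e h) = croots st G := rfl

end Roots

/-! ## §2 Sanity -/

namespace Sanity

/-- three births `a b c : ℕ` (the label IS the step here), joined `((a b)₅ c)₅` in ONE cluster of step `5`: three parts,
one join; joined `((a b)₄ c)₅`: the top join has two parts, the inner merger is a second join -/
example :
    (jparts (fun n : ℕ => n) (Gen.merge (Gen.merge (Gen.born 0 0) (Gen.born 1 1) 5) (Gen.born 2 2) 5)).length = 3 ∧
    (croots (fun n : ℕ => n) (Gen.merge (Gen.merge (Gen.born 0 0) (Gen.born 1 1) 5) (Gen.born 2 2) 5)).length = 1 ∧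
    (jparts (fun n : ℕ => n) (Gen.merge (Gen.merge (Gen.born 0 0) (Gen.born 1 1) 4) (Gen.born 2 2) 5)).length = 2 ∧
    (croots (fun n : ℕ => n) (Gen.merge (Gen.merge (Gen.born 0 0) (Gen.born 1 1) 4) (Gen.born 2 2) 5)).length = 2 := by
  decide

end Sanity

end Summit.QuantumFields.BalabanUV.T4Continuum.HistoryJoins
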